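import Summits.HodgeConjecture.HodgeConjecture.Theorems.CyclicUnitaryPowersHodgeGenericDeckCommutators
import HarnessLib

/-!
# Route `CyclicUnitaryPowers` — what crux K1-A needs AT A POINT is exactly: a finite-index subgroup of the monodromy
# group inside the Mumford–Tate group (the per-point core factored through its true hypothesis)

Support file for `stmt-HodgeConjecture-19544` (`--supports`; nothing here closes an item). Prover seat
`hodge-nonav-prover-Ax` (g13, cell hodge-nonav), brick PENCIL-1 of the scoped programme «PENCIL» (memo
HOME/memos/PROGRAMME-AE-PENCIL-Ax-g13.md §2).

`CyclicUnitaryPowersHodgeGenericDeckCommutators.deck_comm_model_of_hodgeGeneric` (prover-Bx) proves `Deck ∧ Comm` for the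
model `X_F = V(x₃^p − f)` at a HODGE-GENERIC point of a Carlson–Toledo structure `𝔉`; Hodge-genericity is used at ONE line,
through Deligne's lemma (CMSP 15.3.7 (i), the tree theorem
`deligne_finiteIndex_monodromy_le_mumfordTateGroup_of_isQuasiProjectiveOver`): «some finite-index subgroup `Γ'` of the
monodromy group `Γ_{pt f}` lies in `MT(H²(𝒴_{pt f}))`». This file re-runs the same proof from THAT hypothesis (`hΓ`)
instead of Hodge-genericity:

* `deck_comm_model_of_finiteIndex_le_mumfordTate` — the per-point core from `hΓ` (proof: prover-Bx's, verbatim after the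
  `obtain`);
* `exists_deck_comm_of_finiteIndex_le_mumfordTate` — transfer to every `X` cut out by `x₃^p − f`;
* `hodgeConjectureFor_powers_of_finiteIndex_le_mumfordTate` — HC on all self fibre powers (PROVED crux K2);
(At a Hodge-generic point Deligne's lemma supplies `hΓ`, giving back `hodgeConjectureFor_powers_of_hodgeGeneric`.)

Why: `hΓ` can be supplied by OTHER means than Hodge-genericity in the full family — e.g. by Deligne's lemma for a
ONE-PARAMETER sub-family (pencil) whose monodromy has finite index in `Γ_{pt f}` (a Lefschetz∕Zariski-type input), where
the pencil's own non-generic set is COUNTABLE (`SurfacePencilHodgeGenericCountable`, CDK-free). HONEST FRAMING: a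
refactoring; nothing here says HC ∕ HC_AV is proved; 19544 stays at its CDK floor.

## References
* [CarlsonMullerStachPeters2017] J. Carlson, S. Müller-Stach, C. Peters, Period Mappings and Period Domains, 2nd ed.,
  Def. 15.3.5, Lemma–Def. 15.3.7.
* [CarlsonToledo1999] J. A. Carlson, D. Toledo, Duke Math. J. 97 (1999), §7 Theorem 7.1.
* [Deligne1972WeilK3] P. Deligne, La conjecture de Weil pour les surfaces K3, Invent. Math. 15 (1972), Prop. 7.5.
* [RamonMari2008] J. J. Ramón Marí, the K3 precedent of K2, Thm. 3.3.
-/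

noncomputable section

set_option linter.dupNamespace false

namespace Summit.HodgeConjecture.HodgeConjecture.Theorems.CyclicUnitaryPowersFiniteIndexMonodromyDeckCommutators

open Literature.AlgebraicGeometry.Motives Literature.AlgebraicGeometry.HodgeTheory
open Literature.AlgebraicGeometry.HodgeTheory.BettiUniverse
open Literature.AlgebraicGeometry.Motives.UniversalHypersurface Literature.AlgebraicGeometry.HodgeTheory.UniversalHypersurface
open Literature.AlgebraicTopology.SingularHomology
open CategoryTheory CategoryTheory.Limits
open Summit.HodgeConjecture.HodgeConjecture.Theorems.CyclicUnitaryPowersDeckModelClauses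
open Summit.HodgeConjecture.HodgeConjecture.Theorems.CyclicUnitaryPowersK1OfPrintNumbers
open Summit.HodgeConjecture.HodgeConjecture.Theorems.CyclicUnitaryPowersModelTransfer
open Summit.HodgeConjecture.HodgeConjecture.Theorems.SmoothHypersurfaceGeometricGenus (Arapura2012_hypersurface_geometricGenus_holds)
open Summit.HodgeConjecture.HodgeConjecture.Theorems.CyclicUnitaryPowersHodgeGenericDeckCommutators
open Summit.HodgeConjecture.HodgeConjecture.Theses.CyclicUnitaryPowers

/-! ### §1 The per-point core from a finite-index monodromy subgroup inside the Mumford–Tate group -/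

/-- **Deck clauses and deck-unitary commutators in the Hodge group, from a finite-index subgroup of monodromy inside
`MT`.**  Setting of `deck_comm_model_of_hodgeGeneric` (`p ≥ 7` prime, `𝔉 : CarlsonToledoFamily p`, `f ≠ 0` a ternary
`p`-form with smooth model `X_F`, Hodge-symmetric fibre models `A`), with Hodge-genericity of `pt f` REPLACED by its one
consequence the proof uses: `hΓ : ∃ Γ' ≤ Γ_{pt f}` of finite index with `Γ' ≤ MT(H²(𝒴_{pt f}))` (CMSP 15.3.7 (i)). Then
`σ_F` satisfies `Deck` and `Comm` (commutators of deck-unitary automorphisms lie in `(⁅Γ',Γ'⁆)^Zar(ℚ) ⊆ Hg` by the PROVED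
Carlson–Toledo density and `mem_hodgeGroup_of_mem_glZariskiClosure_commutator`). Proof verbatim prover-Bx's.
[cite: CarlsonMullerStachPeters2017, Lemma–Definition 15.3.7] [cite: CarlsonToledo1999, §7 Theorem 7.1]
[cite: Deligne1972WeilK3, Prop. 7.5] -/
theorem deck_comm_model_of_finiteIndex_le_mumfordTate {p : ℕ} (hp : p.Prime) (h7 : 7 ≤ p) (𝔉 : CarlsonToledoFamily p)
    (f : MvPolynomial (Fin 3) ℂ) (hf : f.IsHomogeneous p) (hf0 : f ≠ 0)
    (hXF : IsSmoothProjective 2 (SmoothHypersurface.hypersurface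
      (MvPolynomial.X (Fin.last 3) ^ p - MvPolynomial.rename Fin.castSucc f)))
    (ha : (fun i : Fin 4 => if i = Fin.last 3 then
        (Units.mk0 (Complex.exp (2 * (Real.pi : ℂ) * Complex.I / (p : ℂ))) (Complex.exp_ne_zero _)) else 1) ∈
      diagonalStabilizer (MvPolynomial.X (Fin.last 3) ^ p - MvPolynomial.rename Fin.castSucc f))
    (A : ∀ t : ComplexPoints 𝔉.S, HodgeModel 2 (fiberOver 𝔉.u t)) (hA : ∀ t, (A t).IsHodgeSymmetric)
    (hΓ : haveI : HodgeTensorFacts.{0, 0} := hodgeTensorFacts_holds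
      haveI : ∀ t : ComplexPoints 𝔉.S, Module.Finite ℚ (bettiCohomology (fiberOver 𝔉.u t) 2) := fun t => 𝔉.finite t 2
      ∃ Γ' : Subgroup (bettiCohomology (fiberOver 𝔉.u (𝔉.pt f)) 2 ≃ₗ[ℚ] bettiCohomology (fiberOver 𝔉.u (𝔉.pt f)) 2),
        Γ' ≤ ratMonodromyGroup 𝔉.u 2 𝔉.locallyTrivial ⟨𝔉.pt f, Set.mem_univ _⟩ ∧
        (Γ'.subgroupOf (ratMonodromyGroup 𝔉.u 2 𝔉.locallyTrivial ⟨𝔉.pt f, Set.mem_univ _⟩)).FiniteIndex ∧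
        Γ' ≤ ((A (𝔉.pt f)).hodgeStructure (𝔉.isSmoothProjectiveFamily.isSmoothProjective (𝔉.pt f)) (hA (𝔉.pt f))
          2).mumfordTateGroup) :
    let pmul : List ℕ → List ℕ → List ℕ := fun a b => (List.range (a.length + b.length - 1)).map fun k => ((List.range (k + 1)).map fun i => a.getD i 0 * b.getD (k - i) 0).sum; let ehn : ℕ → ℕ → ℕ → ℕ := fun p j q => if (q + 1) * p < 3 + j then 0 else ((List.replicate 3 (List.replicate (p - 1) 1)).foldl pmul [1]).getD ((q + 1) * p - 3 - j) 0; let Deck : (p : ℕ) → (X : SchemeOver ℂ) → IsSmoothProjective 2 X → (X ⟶ X) → Prop := fun p X hX σ => pull σ 2 ^ p = 1 ∧ (∀ x y, tr hX (2 + 2) (cup X 2 2 (pull σ 2 x) (pull σ 2 y)) = tr hX (2 + 2) (cup X 2 2 x y)) ∧ Module.finrank ℚ ↥(Module.End.eigenspace (pull σ 2) 1) = 1 ∧ ∃ ζ : ℂ, IsPrimitiveRoot ζ p ∧ ∀ j q : ℕ, 1 ≤ j → j < p → q ≤ 2 → Module.finrank ℂ ↥(Module.End.eigenspace ((pull σ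 2).baseChange ℂ) (ζ ^ j) ⊓ (hodge exists_isReal_hodgeModel_holds hX 2).piece ((2 : ℤ) - q) q) = ehn p j q; let Uni : (X : SchemeOver ℂ) → IsSmoothProjective 2 X → (X ⟶ X) → (bettiCohomology X 2 ≃ₗ[ℚ] bettiCohomology X 2) → Prop := fun X hX σ g => (∀ x, g (pull σ 2 x) = pull σ 2 (g x)) ∧ ∀ x y, tr hX (2 + 2) (cup X 2 2 (g x) (g y)) = tr hX (2 + 2) (cup X 2 2 x y); let Comm : (X : SchemeOver ℂ) → IsSmoothProjective 2 X → (X ⟶ X) → Prop := fun X hX σ => haveI := finite hX 2; haveI : HodgeTensorFacts.{0, 0} := hodgeTensorFacts_holds; ∀ g h : bettiCohomology X 2 ≃ₗ[ℚ] bettiCohomology X 2, Uni X hX σ g → Uni X hX σ h → g * h * g⁻¹ * h⁻¹ ∈ (hodge exists_isReal_hodgeModel_holds hX 2).hodgeGroup;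
    Deck p (SmoothHypersurface.hypersurface (MvPolynomial.X (Fin.last 3) ^ p - MvPolynomial.rename Fin.castSucc f)) hXF
        (diagonalAut (MvPolynomial.X (Fin.last 3) ^ p - MvPolynomial.rename Fin.castSucc f) ha) ∧
      Comm (SmoothHypersurface.hypersurface (MvPolynomial.X (Fin.last 3) ^ p - MvPolynomial.rename Fin.castSucc f)) hXF
        (diagonalAut (MvPolynomial.X (Fin.last 3) ^ p - MvPolynomial.rename Fin.castSucc f) ha) := by
  intro pmul ehn Deck Uni Comm
  haveI hHTF : HodgeTensorFacts.{0, 0} := hodgeTensorFacts_holds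
  haveI : ∀ t : ComplexPoints 𝔉.S, Module.Finite ℚ (bettiCohomology (fiberOver 𝔉.u t) 2) := fun t => 𝔉.finite t 2
  -- the deck clauses on the model: (o)–(ii) routine (landed), (iii)–(iv) from the PROVED print numbers
  obtain ⟨ha', h1, h2⟩ := exists_cyclicDeckModel_clauses_one_two hp.ne_zero f hXF
  obtain ⟨h3, h4⟩ := cyclicDeckHodge_of_printNumbers Arapura2012_hypersurface_geometricGenus_holds
    EisenbudHarris2016_surface_secondBettiNumber_holds hp h7 f hf hf0 hXF ha
  have h1' : pull (diagonalAut (MvPolynomial.X (Fin.last 3) ^ p - MvPolynomial.rename Fin.castSucc f) ha) 2 ^ p = 1 := by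
    rw [diagonalAut_congr _ ha ha' rfl]; exact h1
  have h2' : ∀ x y, tr hXF (2 + 2) (cup _ 2 2
      (pull (diagonalAut (MvPolynomial.X (Fin.last 3) ^ p - MvPolynomial.rename Fin.castSucc f) ha) 2 x)
      (pull (diagonalAut (MvPolynomial.X (Fin.last 3) ^ p - MvPolynomial.rename Fin.castSucc f) ha) 2 y)) =
      tr hXF (2 + 2) (cup _ 2 2 x y) := by
    rw [diagonalAut_congr _ ha ha' rfl]; exact h2
  refine ⟨⟨h1', h2', h3, h4⟩, ?_⟩
  intro g h hg hh
  -- the envelope kit of the fibre over the classifying point `s = pt f`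
  have hXF' : IsSmoothProjective 2 (SmoothHypersurface.hypersurface (cyclicCoverForm p f)) := hXF
  have haF : deckUnit p ∈ diagonalStabilizer (cyclicCoverForm p f) := ha
  obtain ⟨φ, B, hBs, hBn, τ, hτp, R, hτB, hφτ, hφB, hHG, hfix, hP1, hP2, hP3, hP4, hP5⟩ :=
    𝔉.exists_envelopeKit f hf hf0 hXF' haF exists_isReal_hodgeModel_holds hodgePQ_independent_of_hodgeModel_holds
      h1' h2' h3.le (A (𝔉.pt f)) (hA (𝔉.pt f))
  -- re-type `φ` on the route's spelling of the model (`cyclicCoverForm p f` unfolds to it)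
  obtain ⟨φ, rfl⟩ : ∃ φ' : bettiCohomology (fiberOver 𝔉.u (𝔉.pt f)) 2 ≃ₗ[ℚ]
      bettiCohomology (SmoothHypersurface.hypersurface
        (MvPolynomial.X (Fin.last 3) ^ p - MvPolynomial.rename Fin.castSucc f)) 2, φ' = φ := ⟨φ, rfl⟩
  haveI := finite hXF 2
  have hφτ' : ∀ x, φ (τ x) =
      pull (diagonalAut (MvPolynomial.X (Fin.last 3) ^ p - MvPolynomial.rename Fin.castSucc f) ha) 2 (φ x) := hφτ
  have hφB' : ∀ x y, B x y = tr hXF (2 + 2) (cup (SmoothHypersurface.hypersurface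
      (MvPolynomial.X (Fin.last 3) ^ p - MvPolynomial.rename Fin.castSucc f)) 2 2 (φ x) (φ y)) := hφB
  have hHG' : ∀ k : bettiCohomology (fiberOver 𝔉.u (𝔉.pt f)) 2 ≃ₗ[ℚ] bettiCohomology (fiberOver 𝔉.u (𝔉.pt f)) 2,
      k ∈ ((A (𝔉.pt f)).hodgeStructure (𝔉.isSmoothProjectiveFamily.isSmoothProjective (𝔉.pt f)) (hA (𝔉.pt f)) 2).hodgeGroup →
        (φ.symm.trans k).trans φ ∈ (hodge exists_isReal_hodgeModel_holds hXF 2).hodgeGroup := hHG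
  -- the hypothesis: a finite-index subgroup `Γ'` of the monodromy group inside `MT(H²(𝒴_s))` at `s = pt f`
  obtain ⟨Γ', hΓ'le, hΓ'fi, hΓ'MT⟩ := hΓ
  -- transport the two σ-unitary automorphisms to the fibre
  have hστ : ∀ y, τ (φ.symm y) =
      φ.symm (pull (diagonalAut (MvPolynomial.X (Fin.last 3) ^ p - MvPolynomial.rename Fin.castSucc f) ha) 2 y) :=
    fun y => by
    apply φ.injective
    rw [hφτ', LinearEquiv.apply_symm_apply, LinearEquiv.apply_symm_apply]
  have cenτ : ∀ k : bettiCohomology (SmoothHypersurface.hypersurface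
        (MvPolynomial.X (Fin.last 3) ^ p - MvPolynomial.rename Fin.castSucc f)) 2 ≃ₗ[ℚ]
      bettiCohomology (SmoothHypersurface.hypersurface
        (MvPolynomial.X (Fin.last 3) ^ p - MvPolynomial.rename Fin.castSucc f)) 2,
      (∀ x, k (pull (diagonalAut (MvPolynomial.X (Fin.last 3) ^ p - MvPolynomial.rename Fin.castSucc f) ha) 2 x) =
        pull (diagonalAut (MvPolynomial.X (Fin.last 3) ^ p - MvPolynomial.rename Fin.castSucc f) ha) 2 (k x)) →
      ∀ x, ((φ.trans k).trans φ.symm) (τ x) = τ (((φ.trans k).trans φ.symm) x) := by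
    intro k hk x
    simp only [LinearEquiv.trans_apply]
    rw [hφτ', hk, hστ]
  have cenB : ∀ k : bettiCohomology (SmoothHypersurface.hypersurface
        (MvPolynomial.X (Fin.last 3) ^ p - MvPolynomial.rename Fin.castSucc f)) 2 ≃ₗ[ℚ]
      bettiCohomology (SmoothHypersurface.hypersurface
        (MvPolynomial.X (Fin.last 3) ^ p - MvPolynomial.rename Fin.castSucc f)) 2,
      (∀ x y, tr hXF (2 + 2) (cup (SmoothHypersurface.hypersurface
          (MvPolynomial.X (Fin.last 3) ^ p - MvPolynomial.rename Fin.castSucc f)) 2 2 (k x) (k y)) =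
        tr hXF (2 + 2) (cup (SmoothHypersurface.hypersurface
          (MvPolynomial.X (Fin.last 3) ^ p - MvPolynomial.rename Fin.castSucc f)) 2 2 x y)) →
      ∀ x y, B (((φ.trans k).trans φ.symm) x) (((φ.trans k).trans φ.symm) y) = B x y := by
    intro k hk x y
    simp only [LinearEquiv.trans_apply]
    rw [hφB', LinearEquiv.apply_symm_apply, LinearEquiv.apply_symm_apply, hk, ← hφB']
  -- B2: the commutator of the transported pair lies in the ℚ-Zariski closure of `⁅Γ', Γ'⁆` (PROVED density theorem)
  have hc : ((φ.trans g).trans φ.symm) * ((φ.trans h).trans φ.symm) * ((φ.trans g).trans φ.symm)⁻¹ *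
      ((φ.trans h).trans φ.symm)⁻¹ ∈ glZariskiClosure ⁅Γ', Γ'⁆ :=
    CyclicUnitaryPowersLaneDCommutatorClosure.unitaryReflectionDensity_of_CT71
      @carlsonToledo1999_unitaryReflection_zariskiDense_holds
      (bettiCohomology (fiberOver 𝔉.u (𝔉.pt f)) 2) B τ p R (ratMonodromyGroup 𝔉.u 2 𝔉.locallyTrivial ⟨𝔉.pt f, Set.mem_univ _⟩)
      hp h7 hBs hBn hτp hτB hfix hP1 hP2 hP3 hP4 hP5 Γ' hΓ'le hΓ'fi
      ((φ.trans g).trans φ.symm) ((φ.trans h).trans φ.symm) (cenτ g hg.1) (cenB g hg.2) (cenτ h hh.1) (cenB h hh.2)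
  -- B1 (landed, any weight): `(⁅Γ', Γ'⁆)^Zar(ℚ) ⊆ Hg` for `Γ' ≤ MT`, the fibre's Hodge structure being polarizable
  have hcomm := mem_hodgeGroup_of_mem_glZariskiClosure_commutator
    ((A (𝔉.pt f)).hodgeStructure (𝔉.isSmoothProjectiveFamily.isSmoothProjective (𝔉.pt f)) (hA (𝔉.pt f)) 2)
    (smoothProjective_hodgeStructure_isPolarizable_holds (𝔉.isSmoothProjectiveFamily.isSmoothProjective (𝔉.pt f))
      (A (𝔉.pt f)) (hA (𝔉.pt f)) 2) hΓ'MT hc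
  -- transport back to `H²(X_F;ℚ)` along `φ`
  have hback := hHG' _ hcomm
  have hid : (φ.symm.trans (((φ.trans g).trans φ.symm) * ((φ.trans h).trans φ.symm) * ((φ.trans g).trans φ.symm)⁻¹ *
      ((φ.trans h).trans φ.symm)⁻¹)).trans φ = g * h * g⁻¹ * h⁻¹ := by
    ext x
    simp only [LinearEquiv.mul_apply, LinearEquiv.trans_apply, LinearEquiv.coe_inv, LinearEquiv.symm_trans_apply,
      LinearEquiv.symm_symm, LinearEquiv.apply_symm_apply]
  rw [← hid]
  exact hback

/-! ### §2 Transfer to every surface cut out by `x₃^p − f`, and the Hodge conjecture on all its powers (fact-free) -/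


/-! ### §2 Transfer to every surface cut out by `x₃^p − f`, and the Hodge conjecture on all its powers -/

/-- **Deck transformation with `Deck ∧ Comm` on every `X` cut out by `x₃^p − f`, from `hΓ`** (the model statement
carried along `e : X ≅ X_F`, as in `exists_deck_comm_of_hodgeGeneric`). [cite: CarlsonMullerStachPeters2017, Lemma–Definition 15.3.7]
[cite: CarlsonToledo1999, §7 Theorem 7.1] -/
theorem exists_deck_comm_of_finiteIndex_le_mumfordTate {p : ℕ} (hp : p.Prime) (h7 : 7 ≤ p) (𝔉 : CarlsonToledoFamily p)
    (f : MvPolynomial (Fin 3) ℂ) (hf : f.IsHomogeneous p) (hf0 : f ≠ 0)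
    (hXF : IsSmoothProjective 2 (SmoothHypersurface.hypersurface
      (MvPolynomial.X (Fin.last 3) ^ p - MvPolynomial.rename Fin.castSucc f)))
    (A : ∀ t : ComplexPoints 𝔉.S, HodgeModel 2 (fiberOver 𝔉.u t)) (hA : ∀ t, (A t).IsHodgeSymmetric)
    (hΓ : haveI : HodgeTensorFacts.{0, 0} := hodgeTensorFacts_holds
      haveI : ∀ t : ComplexPoints 𝔉.S, Module.Finite ℚ (bettiCohomology (fiberOver 𝔉.u t) 2) := fun t => 𝔉.finite t 2
      ∃ Γ' : Subgroup (bettiCohomology (fiberOver 𝔉.u (𝔉.pt f)) 2 ≃ₗ[ℚ] bettiCohomology (fiberOver 𝔉.u (𝔉.pt f)) 2),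
        Γ' ≤ ratMonodromyGroup 𝔉.u 2 𝔉.locallyTrivial ⟨𝔉.pt f, Set.mem_univ _⟩ ∧
        (Γ'.subgroupOf (ratMonodromyGroup 𝔉.u 2 𝔉.locallyTrivial ⟨𝔉.pt f, Set.mem_univ _⟩)).FiniteIndex ∧
        Γ' ≤ ((A (𝔉.pt f)).hodgeStructure (𝔉.isSmoothProjectiveFamily.isSmoothProjective (𝔉.pt f)) (hA (𝔉.pt f))
          2).mumfordTateGroup)
    ⦃X : SchemeOver ℂ⦄ (hX : IsSmoothProjective 2 X)
    (hcut : IsHypersurfaceCutOutBy 3 (MvPolynomial.X (Fin.last 3) ^ p - MvPolynomial.rename Fin.castSucc f) X) :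
    let pmul : List ℕ → List ℕ → List ℕ := fun a b => (List.range (a.length + b.length - 1)).map fun k => ((List.range (k + 1)).map fun i => a.getD i 0 * b.getD (k - i) 0).sum; let ehn : ℕ → ℕ → ℕ → ℕ := fun p j q => if (q + 1) * p < 3 + j then 0 else ((List.replicate 3 (List.replicate (p - 1) 1)).foldl pmul [1]).getD ((q + 1) * p - 3 - j) 0; let Deck : (p : ℕ) → (X : SchemeOver ℂ) → IsSmoothProjective 2 X → (X ⟶ X) → Prop := fun p X hX σ => pull σ 2 ^ p = 1 ∧ (∀ x y, tr hX (2 + 2) (cup X 2 2 (pull σ 2 x) (pull σ 2 y)) = tr hX (2 + 2) (cup X 2 2 x y)) ∧ Module.finrank ℚ ↥(Module.End.eigenspace (pull σ 2) 1) = 1 ∧ ∃ ζ : ℂ, IsPrimitiveRoot ζ p ∧ ∀ j q : ℕ, 1 ≤ j → j < p → q ≤ 2 → Module.finrank ℂ ↥(Module.End.eigenspace ((pull σ 2).baseChange ℂ) (ζ ^ j) ⊓ (hodge exists_isReal_hodgeModel_holds hX 2).piece ((2 : ℤ) - q) q) = ehn p j q; let Uni : (X : SchemeOver ℂ) → IsSmoothProjective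 2 X → (X ⟶ X) → (bettiCohomology X 2 ≃ₗ[ℚ] bettiCohomology X 2) → Prop := fun X hX σ g => (∀ x, g (pull σ 2 x) = pull σ 2 (g x)) ∧ ∀ x y, tr hX (2 + 2) (cup X 2 2 (g x) (g y)) = tr hX (2 + 2) (cup X 2 2 x y); let Comm : (X : SchemeOver ℂ) → IsSmoothProjective 2 X → (X ⟶ X) → Prop := fun X hX σ => haveI := finite hX 2; haveI : HodgeTensorFacts.{0, 0} := hodgeTensorFacts_holds; ∀ g h : bettiCohomology X 2 ≃ₗ[ℚ] bettiCohomology X 2, Uni X hX σ g → Uni X hX σ h → g * h * g⁻¹ * h⁻¹ ∈ (hodge exists_isReal_hodgeModel_holds hX 2).hodgeGroup;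
    ∃ σ : X ⟶ X, Deck p X hX σ ∧ Comm X hX σ := by
  intro pmul ehn Deck Uni Comm
  obtain ⟨e⟩ := hcut.nonempty_iso_hypersurface
  have ha := rootUnits_mem_diagonalStabilizer hp.ne_zero f
  obtain ⟨hDeck, hComm⟩ := deck_comm_model_of_finiteIndex_le_mumfordTate hp h7 𝔉 f hf hf0 hXF ha A hA hΓ
  dsimp only [Deck, Uni, Comm] at hDeck hComm ⊢
  obtain ⟨h1, h2, h3, ζ, hζ, h4⟩ := hDeck
  refine ⟨e.hom ≫ diagonalAut _ ha ≫ e.inv, ⟨pull_conj_pow_eq_one_of_iso e h1,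
    tr_cup_pull_conj_of_iso hX hXF e h2, ?_, ζ, hζ, fun j q hj hjp hq ↦ ?_⟩, ?_⟩
  · rw [finrank_eigenspace_pull_conj_of_iso]
    exact h3
  · rw [finrank_eigenspace_inf_piece_eq_of_iso exists_isReal_hodgeModel_holds
      hodgePQ_independent_of_hodgeModel_holds hX hXF e (diagonalAut _ ha) 2]
    exact h4 j q hj hjp hq
  · haveI : HodgeTensorFacts.{0, 0} := hodgeTensorFacts_holds
    exact comm_of_iso exists_isReal_hodgeModel_holds hodgePQ_independent_of_hodgeModel_holds hX hXF e
      (diagonalAut _ ha) 2 hComm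


/-- **The Hodge conjecture on every self fibre power of `X`, from `hΓ`** (PROVED crux K2 `powersHodgeOfDeckCommutators` at the
PROVED balancing, fed with `exists_deck_comm_of_finiteIndex_le_mumfordTate`). [cite: CarlsonMullerStachPeters2017, Lemma–Definition 15.3.7]
[cite: CarlsonToledo1999, §7 Theorem 7.1] [cite: RamonMari2008, Thm. 3.3 (the K3 precedent of K2)] -/
theorem hodgeConjectureFor_powers_of_finiteIndex_le_mumfordTate {p : ℕ} (hp : p.Prime) (h7 : 7 ≤ p) (𝔉 : CarlsonToledoFamily p)
    (f : MvPolynomial (Fin 3) ℂ) (hf : f.IsHomogeneous p) (hf0 : f ≠ 0)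
    (hXF : IsSmoothProjective 2 (SmoothHypersurface.hypersurface
      (MvPolynomial.X (Fin.last 3) ^ p - MvPolynomial.rename Fin.castSucc f)))
    (A : ∀ t : ComplexPoints 𝔉.S, HodgeModel 2 (fiberOver 𝔉.u t)) (hA : ∀ t, (A t).IsHodgeSymmetric)
    (hΓ : haveI : HodgeTensorFacts.{0, 0} := hodgeTensorFacts_holds
      haveI : ∀ t : ComplexPoints 𝔉.S, Module.Finite ℚ (bettiCohomology (fiberOver 𝔉.u t) 2) := fun t => 𝔉.finite t 2
      ∃ Γ' : Subgroup (bettiCohomology (fiberOver 𝔉.u (𝔉.pt f)) 2 ≃ₗ[ℚ] bettiCohomology (fiberOver 𝔉.u (𝔉.pt f)) 2),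
        Γ' ≤ ratMonodromyGroup 𝔉.u 2 𝔉.locallyTrivial ⟨𝔉.pt f, Set.mem_univ _⟩ ∧
        (Γ'.subgroupOf (ratMonodromyGroup 𝔉.u 2 𝔉.locallyTrivial ⟨𝔉.pt f, Set.mem_univ _⟩)).FiniteIndex ∧
        Γ' ≤ ((A (𝔉.pt f)).hodgeStructure (𝔉.isSmoothProjectiveFamily.isSmoothProjective (𝔉.pt f)) (hA (𝔉.pt f))
          2).mumfordTateGroup)
    ⦃X : SchemeOver ℂ⦄ (hX : IsSmoothProjective 2 X)
    (hcut : IsHypersurfaceCutOutBy 3 (MvPolynomial.X (Fin.last 3) ^ p - MvPolynomial.rename Fin.castSucc f) X)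
    ⦃k : ℕ⦄ ⦃Y : SchemeOver ℂ⦄ (hY : ∃ π : Fin (k + 1) → (Y ⟶ X), Nonempty (IsLimit (Fan.mk Y π))) :
    HodgeConjectureFor (2 * (k + 1)) Y :=
  CyclicUnitaryPowersPowersHodgeOfDeckCommutators.powersHodgeOfDeckCommutators hp h7
    (detSupportsBalanced_holds p h7) hX ⟨f, hf, hcut⟩
    (exists_deck_comm_of_finiteIndex_le_mumfordTate hp h7 𝔉 f hf hf0 hXF A hA hΓ hX hcut) hY

/-! ### §3 The constructed family `cyclicCoverFamily p`: the same conclusions from F1‡ alone -/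

end Summit.HodgeConjecture.HodgeConjecture.Theorems.CyclicUnitaryPowersFiniteIndexMonodromyDeckCommutators

end
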